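import Literature.Topology.FourManifolds.SurfaceGroupNielsenCoreFrame
import Literature.Topology.FourManifolds.SurfaceGroupNielsenAssembly
import Literature.GroupTheory.CombinatorialGroupTheory.QuadraticWordsReduction
import Literature.GroupTheory.CombinatorialGroupTheory.BinaryProductTiling
import Literature.GroupTheory.CombinatorialGroupTheory.FreeGroupCyclicConjugates
import HarnessLib

/-!
# Nielsen's theorem, pillar CORE: minimal configurations are cyclically Nielsen reduced

Topic `Literature/Topology/FourManifolds`.  Layer (P1) of the minimal-counterexample form of
Zieschang's homotopic shortening theorem (Zieschang–Vogt–Coldewey, LNM 835, Thm. 5.2.6 and the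
first sentences of the proof of Thm. 5.3.2: *"Let the binary product have the Nielsen properties
5.2.6 (a), (b) … No factor `Xᵢ` then has more than half of itself cancelled by either
neighbour"*), for the configurations `Config φ` of `SurfaceGroupNielsenCoreFrame.lean`:

* `Config.vals`, `Config.U` — the cyclic list of the values `Ŷ(x)` of the letters `x` of the
  quadratic word `w` of a configuration, and the list of their reduced words; `value_eq_prod`;
* `Config.bar`, `isPairing_bar` — the pairing of the factors by partner letters (the two letters
  of a symbol carry inverse values);
* `Config.transport` — transport of a configuration along a related marking (a permutation `w'`
  of `w` and an automorphism `ψ` with `ψ(w')` conjugate to `w`): the value is conjugated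
  (`transport_value`), the closed-path length is unchanged (`transport_ell`), the measure is
  that of the transformed assignment (`transport_zM`); the special case of a rotation
  (`Config.rotateCfg`, same potential, `IsMin.rotateCfg`);
* the consequences of minimality for an indecomposable, marked non-trivial assignment: no letter
  has trivial value (`val_ne_one`), no symbol is inessential (`no_inessential`: a cyclically
  adjacent pair `x x̄` would be a symbol-closed proper block of trivial value of a related
  marking, contradicting indecomposability), and the cyclic sequence of values is cyclically
  Nielsen reduced (`cyclicallyReduced_vals`: otherwise the step lemma
  `exists_related_zMeasure_lt'` of `QuadraticWordsReduction.lean` produces a related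
  configuration with the same closed-path length and smaller measure); hence the list of value
  words has the cyclic Nielsen property (`cycNielsen_U`) and the cyclically reduced value is a
  rotation of the closed path of the kernels (`exists_reduceCyclically_value_eq_rotate`,
  `ell_eq_length_closedPath`, by the kernel tiling of `BinaryProductTiling.lean`).

## References

* H. Zieschang, E. Vogt, H.-D. Coldewey, *Surfaces and Planar Discontinuous Groups*, LNM 835
  (1980), §5.2 (5.2.5, Thm. 5.2.6), §5.3 (5.3.1, proof of Thm. 5.3.2). [ZieschangVogtColdewey1980]
* H. Zieschang, *Alternierende Produkte in freien Gruppen*, Abh. Math. Sem. Univ. Hamburg 27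
  (1964) 13–31. [Zieschang1964]
-/

noncomputable section

namespace Literature.Topology.FourManifolds

open Literature.GroupTheory.CombinatorialGroupTheory List

namespace SurfaceGroup

variable {g : ℕ}

/-! ## Three free-group lemmas -/

/-- A rotation of a word is the conjugate of the word by the inverse of the rotated prefix.
[folklore] -/
theorem mk_rotate_eq_conj_mod {ι : Type*} (w : List (ι × Bool)) (k : ℕ) :
    FreeGroup.mk (w.rotate k) =
      (FreeGroup.mk (w.take (k % w.length)))⁻¹ * FreeGroup.mk w * FreeGroup.mk (w.take (k % w.length)) := by
  have hw : FreeGroup.mk w =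
      FreeGroup.mk (w.take (k % w.length)) * FreeGroup.mk (w.drop (k % w.length)) := by
    rw [← mk_append, List.take_append_drop]
  rw [List.rotate_eq_drop_append_take_mod, hw, mk_append]
  group

/-- The length of the cyclic reduction is a conjugacy invariant. [folklore] -/
theorem length_reduceCyclically_toWord_conj {ι : Type*} [DecidableEq ι] (x d : FreeGroup ι) :
    (FreeGroup.reduceCyclically (FreeGroup.toWord (d * x * d⁻¹))).length =
      (FreeGroup.reduceCyclically (FreeGroup.toWord x)).length := by
  obtain ⟨e, he⟩ := exists_eq_conj_mk_reduceCyclically x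
  have hC : FreeGroup.IsCyclicallyReduced (FreeGroup.reduceCyclically (FreeGroup.toWord x)) :=
    FreeGroup.reduceCyclically.isCyclicallyReduced FreeGroup.isReduced_toWord
  have hx : d * x * d⁻¹ =
      (d * e) * FreeGroup.mk (FreeGroup.reduceCyclically (FreeGroup.toWord x)) * (d * e)⁻¹ := by
    conv_lhs => rw [he]
    group
  rw [hx, length_reduceCyclically_conj hC]

/-- The word `x x̄` is trivial. [folklore] -/
theorem mk_letter_partner {ι : Type*} (x : ι × Bool) : FreeGroup.mk [x, (x.1, !x.2)] = 1 := by
  rw [show [x, (x.1, !x.2)] = [x] ++ [(x.1, !x.2)] from rfl, mk_append, mk_inv_letter,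
    mul_inv_cancel]

namespace Config

variable {φ : surfaceGen g → SurfaceGroup g}

/-! ## The values of the letters -/

/-- The cyclic list of the **values** `Ŷ(x)` of the letters `x` of the quadratic word of a
configuration (the factors of the binary product). [cite: ZieschangVogtColdewey1980, 5.2.1] -/
def vals (κ : Config φ) : List (FreeGroup (surfaceGen g)) :=
  κ.w.map fun x => FreeGroup.lift κ.Y (sgen x.1 x.2)

/-- The cyclic list of the **value words**: the reduced words of the values of the letters.
[cite: ZieschangVogtColdewey1980, proof of Thm. 5.3.2] -/
def U (κ : Config φ) : List (List (surfaceGen g × Bool)) := κ.vals.map FreeGroup.toWord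

/-- The values are the signed values `val Y`. [folklore] -/
theorem vals_eq_map_val (κ : Config φ) : κ.vals = κ.w.map (val κ.Y) :=
  map_congr_left fun x _ => lift_sgen κ.Y x

/-- **The value of a configuration is the product of the values of its letters.** [folklore] -/
theorem value_eq_prod (κ : Config φ) : κ.value = κ.vals.prod := by
  rw [vals_eq_map_val, value, lift_mk_eq_prod_map_val]

/-- The number of values is the length of the word. [folklore] -/
@[simp] theorem length_vals (κ : Config φ) : κ.vals.length = κ.w.length := by
  rw [vals, length_map]

/-- The number of value words is the length of the word. [folklore] -/
@[simp] theorem length_U (κ : Config φ) : κ.U.length = κ.w.length := by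
  rw [U, length_map, length_vals]

/-- The values are the free-group elements of the value words. [folklore] -/
theorem map_mk_U (κ : Config φ) : κ.U.map FreeGroup.mk = κ.vals := by
  rw [U, map_map]
  conv_rhs => rw [← map_id κ.vals]
  exact map_congr_left fun x _ => FreeGroup.mk_toWord

/-- The `j`-th value. [folklore] -/
theorem getElem_vals (κ : Config φ) {j : ℕ} (hj : j < κ.vals.length) :
    κ.vals[j] = FreeGroup.lift κ.Y (sgen (κ.w[j]'(by simpa using hj)).1 (κ.w[j]'(by simpa using hj)).2) := by
  simp [vals]

/-- The `j`-th value word. [folklore] -/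
theorem getElem_U (κ : Config φ) {j : ℕ} (hj : j < κ.U.length) :
    κ.U[j] = (FreeGroup.lift κ.Y (sgen (κ.w[j]'(by simpa using hj)).1 (κ.w[j]'(by simpa using hj)).2)).toWord := by
  simp [U, vals]

/-! ## The quadratic word -/

/-- The word of a configuration is an alternating quadratic word. [folklore] -/
theorem isQuadratic_w (κ : Config φ) : IsQuadratic κ.w :=
  (isQuadratic_surfaceWordStd g).perm κ.perm.symm

/-- The word of a configuration has length `4g`. [folklore] -/
theorem length_w (κ : Config φ) : κ.w.length = 4 * g :=
  κ.perm.length_eq.trans (length_surfaceWordStd g)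

/-- The word of a configuration has no repeated letter. [folklore] -/
theorem nodup_w (κ : Config φ) : κ.w.Nodup :=
  κ.perm.nodup_iff.2 (nodup_surfaceWordStd g)

/-- Every letter occurs in the word of a configuration. [folklore] -/
theorem mem_w (κ : Config φ) (x : surfaceGen g × Bool) : x ∈ κ.w :=
  κ.perm.mem_iff.2 (mem_surfaceWordStd x)

/-- In positive genus the word of a configuration is non-empty. [folklore] -/
theorem w_ne_nil (κ : Config φ) (hg : 1 ≤ g) : κ.w ≠ [] := by
  rw [Ne, ← length_eq_zero_iff, length_w]
  omega

/-- In positive genus the list of value words is non-empty. [folklore] -/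
theorem U_ne_nil (κ : Config φ) (hg : 1 ≤ g) : κ.U ≠ [] := by
  rw [Ne, ← length_eq_zero_iff, length_U, length_w]
  omega

/-! ## The pairing of the factors by partner letters -/

/-- **The pairing**: the index of the partner letter `x̄ = (x.1, !x.2)` of the `k`-th letter `x`
of `w` (and `k` itself out of range). [cite: ZieschangVogtColdewey1980, 5.3.1] -/
def bar (κ : Config φ) (k : ℕ) : ℕ :=
  ((κ.w[k]?).map fun x => κ.w.idxOf (x.1, !x.2)).getD k

/-- The pairing at an index in range. [folklore] -/
theorem bar_eq (κ : Config φ) {k : ℕ} (hk : k < κ.w.length) :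
    κ.bar k = κ.w.idxOf ((κ.w[k]).1, !(κ.w[k]).2) := by
  simp only [bar, getElem?_eq_getElem hk, Option.map_some, Option.getD_some]

/-- The partner index is in range. [folklore] -/
theorem bar_lt (κ : Config φ) {k : ℕ} (hk : k < κ.w.length) : κ.bar k < κ.w.length := by
  rw [bar_eq κ hk]
  exact idxOf_lt_length_of_mem (κ.mem_w _)

/-- **The letter at the partner index is the partner letter.** [folklore] -/
theorem getElem_bar (κ : Config φ) {k : ℕ} (hk : k < κ.w.length)
    (h : κ.bar k < κ.w.length := κ.bar_lt hk) :
    κ.w[κ.bar k] = ((κ.w[k]).1, !(κ.w[k]).2) := by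
  have key : ∀ (j : ℕ) (hj : j < κ.w.length), j = κ.w.idxOf ((κ.w[k]).1, !(κ.w[k]).2) →
      κ.w[j] = ((κ.w[k]).1, !(κ.w[k]).2) := by
    rintro j hj rfl
    exact getElem_idxOf hj
  exact key _ h (bar_eq κ hk)

/-- The pairing is an involution. [folklore] -/
theorem bar_bar (κ : Config φ) {k : ℕ} (hk : k < κ.w.length) : κ.bar (κ.bar k) = k := by
  rw [bar_eq κ (κ.bar_lt hk), getElem_bar κ hk]
  simp only [Bool.not_not, Prod.mk.eta]
  exact κ.nodup_w.idxOf_getElem k hk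

/-- The pairing has no fixed point. [folklore] -/
theorem bar_ne (κ : Config φ) {k : ℕ} (hk : k < κ.w.length) : κ.bar k ≠ k := by
  intro h
  have e := getElem_bar κ hk
  simp only [h] at e
  have := congrArg Prod.snd e
  simp at this

/-- Partner letters have inverse values. [folklore] -/
theorem lift_sgen_partner (κ : Config φ) (x : surfaceGen g × Bool) :
    FreeGroup.lift κ.Y (sgen x.1 (!x.2)) = (FreeGroup.lift κ.Y (sgen x.1 x.2))⁻¹ := by
  rw [sgen_not, map_inv]

/-- **The factors are paired by partner letters**: `bar` is a fixed-point free involution of the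
indices exchanging formally inverse value words. [cite: ZieschangVogtColdewey1980, 5.3.1] -/
theorem isPairing_bar (κ : Config φ) : CycFactors.IsPairing κ.U κ.bar where
  lt k hk := by
    rw [length_U] at hk ⊢
    exact κ.bar_lt hk
  bar_bar k hk := κ.bar_bar (by simpa using hk)
  bar_ne k hk := κ.bar_ne (by simpa using hk)
  fac_bar k hk := by
    have hk' : k < κ.w.length := by simpa using hk
    have hb : κ.bar k < κ.U.length := by simpa using κ.bar_lt hk'
    rw [CycFactors.fac_eq_getElem _ hb, CycFactors.fac_eq_getElem _ hk, getElem_U, getElem_U,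
      getElem_bar κ hk', ← FreeGroup.toWord_inv, ← lift_sgen_partner]

/-! ## Transport along a related marking -/

/-- **Transport of a configuration along a related marking**: a permutation `w'` of `w` and an
automorphism `ψ` with `ψ(w') = c₁ w c₁⁻¹` give the configuration with word `w'`, marking
`θ ∘ ψ`, conjugator `θ(c₁) c` and lift `Ŷ ∘ ψ` (ZVC 5.2.4: *"Related binary products have the
same value"*, up to conjugation). [cite: ZieschangVogtColdewey1980, 5.2.4 and 5.3.1] -/
def transport (κ : Config φ) (w' : List (surfaceGen g × Bool)) (ψ : MulAut (FreeGroup (surfaceGen g)))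
    (c₁ : FreeGroup (surfaceGen g)) (hperm : w' ~ κ.w)
    (hψ : ψ (FreeGroup.mk w') = c₁ * FreeGroup.mk κ.w * c₁⁻¹) : Config φ where
  w := w'
  θ := ψ.trans κ.θ
  c := κ.θ c₁ * κ.c
  Y := fun i => FreeGroup.lift κ.Y (ψ (FreeGroup.of i))
  perm := hperm.trans κ.perm
  marking := by
    rw [MulEquiv.trans_apply, hψ, map_mul, map_mul, κ.marking, map_inv]
    group
  lift i := by
    have h := DFunLike.congr_fun κ.proj_comp_lift (ψ (FreeGroup.of i))
    simpa using h

section Transport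

variable (κ : Config φ) (w' : List (surfaceGen g × Bool)) (ψ : MulAut (FreeGroup (surfaceGen g)))
  (c₁ : FreeGroup (surfaceGen g)) (hperm : w' ~ κ.w)
  (hψ : ψ (FreeGroup.mk w') = c₁ * FreeGroup.mk κ.w * c₁⁻¹)

/-- The word of the transported configuration. [folklore] -/
@[simp] theorem transport_w : (κ.transport w' ψ c₁ hperm hψ).w = w' := rfl

/-- The marking of the transported configuration. [folklore] -/
@[simp] theorem transport_θ : (κ.transport w' ψ c₁ hperm hψ).θ = ψ.trans κ.θ := rfl

/-- The conjugator of the transported configuration. [folklore] -/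
@[simp] theorem transport_c : (κ.transport w' ψ c₁ hperm hψ).c = κ.θ c₁ * κ.c := rfl

/-- The lift of the transported configuration is the transformed assignment `Ŷ ∘ ψ`. [folklore] -/
@[simp] theorem transport_Y :
    (κ.transport w' ψ c₁ hperm hψ).Y = fun i => FreeGroup.lift κ.Y (ψ (FreeGroup.of i)) := rfl

/-- The transformed assignment as a homomorphism is `Ŷ ∘ ψ`. [folklore] -/
theorem lift_transport_Y :
    FreeGroup.lift (κ.transport w' ψ c₁ hperm hψ).Y = (FreeGroup.lift κ.Y).comp ψ.toMonoidHom :=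
  FreeGroup.ext_hom _ _ fun i => by simp [transport]

/-- **The value of the transported configuration is conjugate to the value.**
[cite: ZieschangVogtColdewey1980, 5.2.4] -/
theorem transport_value :
    (κ.transport w' ψ c₁ hperm hψ).value =
      FreeGroup.lift κ.Y c₁ * κ.value * (FreeGroup.lift κ.Y c₁)⁻¹ := by
  rw [value, lift_transport_Y, MonoidHom.comp_apply, MulEquiv.coe_toMonoidHom, transport_w, hψ,
    map_mul, map_mul, map_inv, value]

/-- **The closed-path length is invariant under transport.** [cite: ZieschangVogtColdewey1980, Thm. 5.3.2] -/
theorem transport_ell : (κ.transport w' ψ c₁ hperm hψ).ell = κ.ell := by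
  rw [ell, transport_value, length_reduceCyclically_toWord_conj, ell]

/-- The measure of the transported configuration is that of the transformed assignment.
[folklore] -/
theorem transport_zM :
    (κ.transport w' ψ c₁ hperm hψ).zM =
      zMeasure fun i => relabel g (FreeGroup.lift κ.Y (ψ (FreeGroup.of i))) := rfl

/-- The values of the transported configuration. [folklore] -/
theorem transport_vals :
    (κ.transport w' ψ c₁ hperm hψ).vals =
      w'.map fun x => FreeGroup.lift (fun i => FreeGroup.lift κ.Y (ψ (FreeGroup.of i))) (sgen x.1 x.2) :=
  rfl

/-- The potential of the transported configuration. [folklore] -/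
theorem transport_pot :
    (κ.transport w' ψ c₁ hperm hψ).pot =
      toLex (κ.ell, zMeasure fun i => relabel g (FreeGroup.lift κ.Y (ψ (FreeGroup.of i)))) := by
  rw [pot, transport_ell, transport_zM]

end Transport

/-! ## Rotations -/

/-- **Rotation of a configuration**: the transport along the trivial automorphism to the rotated
word (a rotation is conjugation by a prefix). [folklore] -/
def rotateCfg (κ : Config φ) (k : ℕ) : Config φ :=
  κ.transport (κ.w.rotate k) 1 (FreeGroup.mk (κ.w.take (k % κ.w.length)))⁻¹ (rotate_perm κ.w k)
    (by rw [MulAut.one_apply, inv_inv]; exact mk_rotate_eq_conj_mod κ.w k)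

/-- The word of the rotated configuration. [folklore] -/
@[simp] theorem rotateCfg_w (κ : Config φ) (k : ℕ) : (κ.rotateCfg k).w = κ.w.rotate k := rfl

/-- The lift of the rotated configuration is unchanged. [folklore] -/
@[simp] theorem rotateCfg_Y (κ : Config φ) (k : ℕ) : (κ.rotateCfg k).Y = κ.Y := by
  funext i
  show FreeGroup.lift κ.Y ((1 : MulAut (FreeGroup (surfaceGen g))) (FreeGroup.of i)) = κ.Y i
  rw [MulAut.one_apply, FreeGroup.lift_apply_of]

/-- The marking of the rotated configuration is unchanged. [folklore] -/
@[simp] theorem rotateCfg_θ (κ : Config φ) (k : ℕ) : (κ.rotateCfg k).θ = κ.θ := by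
  show (1 : MulAut (FreeGroup (surfaceGen g))).trans κ.θ = κ.θ
  ext x
  rfl

/-- The values of the rotated configuration are the rotated values. [folklore] -/
@[simp] theorem rotateCfg_vals (κ : Config φ) (k : ℕ) : (κ.rotateCfg k).vals = κ.vals.rotate k := by
  rw [vals, rotateCfg_Y, rotateCfg_w, vals, map_rotate]

/-- The value words of the rotated configuration are the rotated value words. [folklore] -/
@[simp] theorem rotateCfg_U (κ : Config φ) (k : ℕ) : (κ.rotateCfg k).U = κ.U.rotate k := by
  rw [U, rotateCfg_vals, U, map_rotate]

/-- Rotation does not change the closed-path length. [folklore] -/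
theorem rotateCfg_ell (κ : Config φ) (k : ℕ) : (κ.rotateCfg k).ell = κ.ell :=
  transport_ell _ _ _ _ _ _

/-- Rotation does not change the measure. [folklore] -/
theorem rotateCfg_zM (κ : Config φ) (k : ℕ) : (κ.rotateCfg k).zM = κ.zM := by
  rw [zM, rotateCfg_Y, zM]

/-- **Rotation does not change the potential.** [folklore] -/
theorem rotateCfg_pot (κ : Config φ) (k : ℕ) : (κ.rotateCfg k).pot = κ.pot := by
  rw [pot, rotateCfg_ell, rotateCfg_zM, pot]

/-- **Rotations of minimal configurations are minimal.** [folklore] -/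
theorem IsMin.rotateCfg {κ : Config φ} (h : κ.IsMin) (k : ℕ) : (κ.rotateCfg k).IsMin :=
  fun κ' hlt => h κ' (by rwa [rotateCfg_pot] at hlt)

/-! ## Consequences of minimality -/

/-- **No value is trivial** for a marked non-trivial assignment (its projection is
`φ̂(θ xᵢ) ≠ 1`). [cite: ZieschangVogtColdewey1980, proof of Thm. 5.3.2] -/
theorem Y_ne_one (κ : Config φ) (hM : MarkedNontrivial φ) (i : surfaceGen g) : κ.Y i ≠ 1 := by
  intro h
  have := κ.lift i
  rw [h, map_one] at this
  exact hM κ.θ i this.symm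

/-- **No letter has trivial value.** [cite: ZieschangVogtColdewey1980, proof of Thm. 5.3.2] -/
theorem val_ne_one (κ : Config φ) (hM : MarkedNontrivial φ) :
    ∀ x ∈ κ.w, FreeGroup.lift κ.Y (sgen x.1 x.2) ≠ 1 := by
  rintro ⟨i, s⟩ -
  cases s
  · simpa using κ.Y_ne_one hM i
  · simpa using κ.Y_ne_one hM i

/-- No symbol of the word has trivial value (the form needed by the step lemma). [folklore] -/
theorem Y_fst_ne_one (κ : Config φ) (hM : MarkedNontrivial φ) : ∀ x ∈ κ.w, κ.Y x.1 ≠ 1 :=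
  fun x _ => κ.Y_ne_one hM x.1

/-- **No symbol is inessential** (ZVC 5.2.5) for an indecomposable assignment: if the two
letters `x, x̄` of a symbol were cyclically adjacent in `w`, then after a rotation the block
`[x, x̄]` would be a non-empty proper symbol-closed block of the related binary product
`x x̄ R` (marked exactly, by composing the marking with an inner automorphism) with value
`φ̂(ψ(x x̄)) = 1`, contradicting indecomposability. [cite: ZieschangVogtColdewey1980, 5.2.5 and 5.3.1 (b)] -/
theorem no_inessential (κ : Config φ) (hI : Indecomposable φ) :
    ∀ k, k < κ.w.length → ∀ (x : surfaceGen g × Bool) (R : List (surfaceGen g × Bool)),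
      κ.w.rotate k ≠ x :: (x.1, !x.2) :: R := by
  intro k hk x R hrot
  -- the exact marking of the rotated word
  have hmark : (κ.θ.trans (MulAut.conj ((κ.θ (FreeGroup.mk (κ.w.take k)))⁻¹ * κ.c)⁻¹))
      (FreeGroup.mk ([] ++ [x, (x.1, !x.2)] ++ R)) = surfaceRelator g := by
    have e1 : ([] ++ [x, (x.1, !x.2)] ++ R) = κ.w.rotate k := by rw [hrot]; rfl
    rw [e1, MulEquiv.trans_apply, MulAut.conj_apply, mk_rotate_eq_conj κ.w hk.le, map_mul,
      map_mul, map_inv, κ.marking]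
    group
  -- the rotated word is quadratic, and no letter of `R` has the symbol of `x`
  have hq : IsQuadratic ([] ++ [x, (x.1, !x.2)] ++ R) := by
    have : IsQuadratic (κ.w.rotate k) := κ.isQuadratic_w.perm (rotate_perm κ.w k).symm
    rw [hrot] at this
    exact this
  have hnd : (x :: (x.1, !x.2) :: R).Nodup := by
    rw [← hrot]
    exact (nodup_rotate).2 κ.nodup_w
  have hR : ∀ z ∈ R, z.1 ≠ x.1 := by
    intro z hz hz1
    rw [nodup_cons, nodup_cons] at hnd
    obtain ⟨hx, hx', -⟩ := hnd
    obtain ⟨z1, z2⟩ := z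
    obtain ⟨x1, x2⟩ := x
    simp only at hz1
    subst hz1
    rcases Bool.eq_or_eq_not z2 x2 with h2 | h2
    · subst h2
      exact hx (mem_cons_of_mem _ hz)
    · subst h2
      exact hx' hz
  have hdisj : ∀ y ∈ [x, (x.1, !x.2)], ∀ z ∈ [] ++ R, y.1 ≠ z.1 := by
    intro y hy z hz
    rw [nil_append] at hz
    have hy1 : y.1 = x.1 := by
      simp only [mem_cons, not_mem_nil, or_false] at hy
      rcases hy with rfl | rfl <;> rfl
    rw [hy1]
    exact (hR z hz).symm
  have hRne : [] ++ R ≠ [] := by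
    have hlen : (κ.w.rotate k).length = 4 * g := by rw [length_rotate, length_w]
    rw [hrot, length_cons, length_cons] at hlen
    have hw := κ.length_w
    rw [nil_append, Ne, ← length_eq_zero_iff]
    omega
  have key := hI _ [] [x, (x.1, !x.2)] R hmark hq hdisj (cons_ne_nil _ _) hRne
  rw [mk_letter_partner, map_one, map_one] at key
  exact key rfl

/-- **Minimal configurations are cyclically Nielsen reduced** (ZVC Thm. 5.2.6 in the
minimal-counterexample form): otherwise the step lemma `exists_related_zMeasure_lt'` (a
rotation and one bifurcation) yields a related configuration with the same closed-path length
and smaller measure, i.e. smaller potential. [cite: ZieschangVogtColdewey1980, Thm. 5.2.6 and proof of Thm. 5.3.2] -/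
theorem cyclicallyReduced_vals (κ : Config φ) (hI : Indecomposable φ) (hM : MarkedNontrivial φ)
    (hmin : κ.IsMin) : CyclicallyReduced κ.vals := by
  by_contra hnot
  obtain ⟨w', ψ, c₁, hperm, hψ, hlt⟩ := exists_related_zMeasure_lt' κ.w κ.isQuadratic_w κ.Y
    (κ.Y_fst_ne_one hM) (κ.no_inessential hI) hnot
  refine hmin (κ.transport w' ψ c₁ hperm hψ) ?_
  rw [transport_pot, pot]
  exact Prod.Lex.right _ hlt

/-- **The value words of a minimal configuration have the cyclic Nielsen property** (via the
bridge `cycNielsen_map_toWord`). [cite: ZieschangVogtColdewey1980, 5.2.6–5.2.7 and proof of Thm. 5.3.2] -/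
theorem cycNielsen_U (κ : Config φ) (hg : 1 ≤ g) (hI : Indecomposable φ) (hM : MarkedNontrivial φ)
    (hmin : κ.IsMin) : CycFactors.CycNielsen κ.U :=
  CycFactors.cycNielsen_map_toWord (by rw [length_vals, length_w]; omega)
    (κ.cyclicallyReduced_vals hI hM hmin)

/-! ## The closed path -/

/-- **The cyclically reduced value of a minimal configuration is a rotation of the closed path
of the kernels.** [cite: ZieschangVogtColdewey1980, proof of Thm. 5.3.2] -/
theorem exists_reduceCyclically_value_eq_rotate (κ : Config φ) (hg : 1 ≤ g) (hI : Indecomposable φ)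
    (hM : MarkedNontrivial φ) (hmin : κ.IsMin) :
    ∃ j, FreeGroup.reduceCyclically (FreeGroup.toWord κ.value) = (CycFactors.closedPath κ.U).rotate j := by
  rw [value_eq_prod, ← map_mk_U]
  exact CycFactors.exists_reduceCyclically_toWord_prod_eq_rotate (κ.cycNielsen_U hg hI hM hmin)
    (κ.U_ne_nil hg)

/-- **The closed-path length of a minimal configuration is the length of the closed path of the
kernels.** [cite: ZieschangVogtColdewey1980, proof of Thm. 5.3.2] -/
theorem ell_eq_length_closedPath (κ : Config φ) (hg : 1 ≤ g) (hI : Indecomposable φ)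
    (hM : MarkedNontrivial φ) (hmin : κ.IsMin) :
    κ.ell = (CycFactors.closedPath κ.U).length := by
  obtain ⟨j, hj⟩ := κ.exists_reduceCyclically_value_eq_rotate hg hI hM hmin
  rw [ell, hj, length_rotate]

/-- The closed path of a minimal configuration is cyclically reduced. [cite: ZieschangVogtColdewey1980, proof of Thm. 5.3.2] -/
theorem isCyclicallyReduced_closedPath (κ : Config φ) (hg : 1 ≤ g) (hI : Indecomposable φ)
    (hM : MarkedNontrivial φ) (hmin : κ.IsMin) :
    FreeGroup.IsCyclicallyReduced (CycFactors.closedPath κ.U) :=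
  CycFactors.isCyclicallyReduced_closedPath (κ.cycNielsen_U hg hI hM hmin) (κ.U_ne_nil hg)

/-- The closed path of a minimal configuration is conjugate to the value.
[cite: ZieschangVogtColdewey1980, proof of Thm. 5.3.2] -/
theorem value_eq_conj_mk_closedPath (κ : Config φ) (hg : 1 ≤ g) (hI : Indecomposable φ)
    (hM : MarkedNontrivial φ) (hmin : κ.IsMin) :
    κ.value = FreeGroup.mk (CycFactors.head κ.U 0) * FreeGroup.mk (CycFactors.closedPath κ.U) *
      (FreeGroup.mk (CycFactors.head κ.U 0))⁻¹ := by
  rw [value_eq_prod, ← map_mk_U]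
  exact CycFactors.prod_map_mk_eq_conj (κ.cycNielsen_U hg hI hM hmin)

end Config

end SurfaceGroup

end Literature.Topology.FourManifolds

end
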